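import Literature.Analysis.FluidPDE.StationaryEulerPlanar
import HarnessLib

/-!
# Planar laminates of order four (Choffrut–Székelyhidi 2014, Prop. 14 (iv))

Topic `Literature/Analysis/FluidPDE`. Support file of the proof of
`Literature.Analysis.FluidPDE.Torus.ChoffrutSzekelyhidi2014_thm1` (Choffrut–Székelyhidi, SIAM
J. Math. Anal. 46 (2014) = arXiv:1401.4301), §5.2: for `r > 0` and the closed set
`V̄_r = {(a, b, c) ∈ L : |c| ≤ r/2, √r|a|(r/2 - c) + √r|b|(r/2 + c) ≤ (r/2 + c)(r/2 - c), a² + b² ≤ r}`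
((5.3) cleared of denominators, caps included), every point with `|c| < r/2` is the barycentre of
an explicit laminate of order four, valid in (the rotation `R_θ` of) `V̄_r`, with atoms in
`𝒦_r ∩ R_θ L` — the segments (5.5)–(5.8) of the paper: a horizontal split to the boundary of the
rhombus slice, a horizontal split of a boundary point into the corners `(±A, 0, c)`, `(0, ±B, c)`,
the oblique splits `(σA, 0, c) ∈ [(σ√r, 0, r/2), (0, 0, -r/2)]`,
`(0, σB, c) ∈ [(0, σ√r, -r/2), (0, 0, r/2)]`, and the cap splits of `(0, 0, ∓r/2)`. Everything is
done at a fixed rotation `(κ, λ) = (cos θ, sin θ)` so that no transport of laminates is needed.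

## References

* A. Choffrut, L. Székelyhidi Jr., SIAM J. Math. Anal. 46 (2014), §5.2, Prop. 14, (5.3)–(5.8).
-/

noncomputable section

open scoped InnerProductSpace Matrix
open Set Function

namespace Literature.Analysis.FluidPDE

namespace StationaryEuler

namespace Frame2

variable {d : Type*} [Fintype d] [DecidableEq d] (φ : Frame2 d)

/-! ## The closed slice set `V̄_r` and its rotations -/

/-- The boundary function of (5.3) cleared of denominators:
`g_r(a, b, c) = √r|a|(r/2 - c) + √r|b|(r/2 + c) - (r/2 + c)(r/2 - c)` (`f_r ≤ 1 ⇔ g_r ≤ 0` for `|c| < r/2`).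
[cite: ChoffrutSzekelyhidi2014, (5.3)] -/
def gfun (r a b c : ℝ) : ℝ :=
  Real.sqrt r * |a| * (r / 2 - c) + Real.sqrt r * |b| * (r / 2 + c) - (r / 2 + c) * (r / 2 - c)

/-- **`V̄_r`** in planar coordinates ((5.3) and the caps of its closure).
[cite: ChoffrutSzekelyhidi2014, Prop. 14 (proof of (i),(ii))] -/
def Wplane (r : ℝ) : Set (ℝ × ℝ × ℝ) :=
  {p | |p.2.2| ≤ r / 2 ∧ p.1 ^ 2 + p.2.1 ^ 2 ≤ r ∧ gfun r p.1 p.2.1 p.2.2 ≤ 0}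

/-- Rotated `L`-points `R_θ(a, b, c)`. [cite: ChoffrutSzekelyhidi2014, (5.1)] -/
def R3 (κ l : ℝ) (p : ℝ × ℝ × ℝ) : State d := φ.rot κ l p.1 p.2.1 p.2.2 0

/-- **`R_θ V̄_r`**: the validity set of the planar laminates. [cite: ChoffrutSzekelyhidi2014, Prop. 14 (iv)] -/
def Wrot (κ l r : ℝ) : Set (State d) := φ.R3 κ l '' Wplane r

variable {κ l r : ℝ}

/-- Convex combinations of rotated `L`-points. [folklore] -/
theorem convexCombo_R3 (κ l t : ℝ) (p q : ℝ × ℝ × ℝ) :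
    t • φ.R3 κ l p + (1 - t) • φ.R3 κ l q = φ.R3 κ l (t • p + (1 - t) • q) := by
  simp only [R3, rot_convex, Prod.smul_fst, Prod.smul_snd, Prod.fst_add, Prod.snd_add, smul_eq_mul]
  rw [mul_zero, mul_zero, add_zero]

/-- **Segments via planar convex combinations**: if all planar convex combinations of `p`, `q` lie
in `V̄_r`, the rotated segment lies in `R_θ V̄_r`. [folklore] -/
theorem segment_R3_subset (p q : ℝ × ℝ × ℝ) (h : ∀ t : ℝ, 0 ≤ t → t ≤ 1 → t • p + (1 - t) • q ∈ Wplane r) :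
    segment ℝ (φ.R3 κ l p) (φ.R3 κ l q) ⊆ φ.Wrot κ l r := by
  rintro x ⟨a, b, ha, hb, hab, rfl⟩
  refine ⟨a • p + (1 - a) • q, h a ha (by linarith), ?_⟩
  rw [← convexCombo_R3, show b = 1 - a by linarith]

/-- **Horizontal slices of `V̄_r` are convex** (the rhombus (5.3)): planar convex combinations of two
points of `V̄_r` at the same height `c` stay in `V̄_r`. [cite: ChoffrutSzekelyhidi2014, Prop. 14 (iv)] -/
theorem slice_convex {a b a' b' c : ℝ} (hp : (a, b, c) ∈ Wplane r) (hq : (a', b', c) ∈ Wplane r)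
    {t : ℝ} (ht0 : 0 ≤ t) (ht1 : t ≤ 1) : t • (a, b, c) + (1 - t) • (a', b', c) ∈ Wplane r := by
  obtain ⟨hc, hn, hg⟩ := hp
  obtain ⟨-, hn', hg'⟩ := hq
  simp only [Prod.smul_mk, smul_eq_mul, Prod.mk_add_mk, show t * c + (1 - t) * c = c by ring]
  refine ⟨hc, ?_, ?_⟩
  · -- convexity of `a² + b²`
    nlinarith [sq_nonneg (a - a'), sq_nonneg (b - b'), mul_nonneg ht0 (sub_nonneg.2 ht1)]
  · -- convexity of `g` in `(a, b)` (coefficients `r/2 ∓ c ≥ 0`)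
    simp only [gfun] at hg hg' ⊢
    have h1 : |t * a + (1 - t) * a'| ≤ t * |a| + (1 - t) * |a'| := by
      calc |t * a + (1 - t) * a'| ≤ |t * a| + |(1 - t) * a'| := abs_add_le _ _
        _ = t * |a| + (1 - t) * |a'| := by rw [abs_mul, abs_mul, abs_of_nonneg ht0, abs_of_nonneg (sub_nonneg.2 ht1)]
    have h2 : |t * b + (1 - t) * b'| ≤ t * |b| + (1 - t) * |b'| := by
      calc |t * b + (1 - t) * b'| ≤ |t * b| + |(1 - t) * b'| := abs_add_le _ _
        _ = t * |b| + (1 - t) * |b'| := by rw [abs_mul, abs_mul, abs_of_nonneg ht0, abs_of_nonneg (sub_nonneg.2 ht1)]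
    have hcp : 0 ≤ r / 2 + c := by linarith [(abs_le.1 hc).1]
    have hcm : 0 ≤ r / 2 - c := by linarith [(abs_le.1 hc).2]
    have hs : 0 ≤ Real.sqrt r := Real.sqrt_nonneg r
    nlinarith [mul_le_mul_of_nonneg_left h1 (mul_nonneg hs hcm), mul_le_mul_of_nonneg_left h2 (mul_nonneg hs hcp),
      mul_nonneg ht0 (sub_nonneg.2 ht1)]

/-! ## The explicit points -/

variable (κ l r)

/-- Rotated `L`-point. [folklore] -/
abbrev P (a b c : ℝ) : State d := φ.rot κ l a b c 0

/-- `R(0, 1)`. [folklore] -/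
abbrev ηa : Ed d := φ.vec2 (-l) κ

/-- `R(1, 0)`. [folklore] -/
abbrev ηb : Ed d := φ.vec2 κ l

/-- **(5.8)**: `(0, 0, -r/2) = ½(0, √r, -r/2) + ½(0, -√r, -r/2)`. [cite: ChoffrutSzekelyhidi2014, (5.8)] -/
def T4a : Laminate d :=
  Laminate.split (1 / 2) (φ.ηb κ l) 0 (Laminate.atom (φ.P κ l 0 (Real.sqrt r) (-(r / 2)))) (Laminate.atom (φ.P κ l 0 (-Real.sqrt r) (-(r / 2))))

/-- **(5.7)**: `(0, 0, r/2) = ½(√r, 0, r/2) + ½(-√r, 0, r/2)`. [cite: ChoffrutSzekelyhidi2014, (5.7)] -/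
def T4b : Laminate d :=
  Laminate.split (1 / 2) (φ.ηa κ l) 0 (Laminate.atom (φ.P κ l (Real.sqrt r) 0 (r / 2))) (Laminate.atom (φ.P κ l (-Real.sqrt r) 0 (r / 2)))

/-- **(5.5)**: `(σA, 0, c) = μ (σ√r, 0, r/2) + (1 - μ)(0, 0, -r/2)`, `μ = (c + r/2)/r`.
[cite: ChoffrutSzekelyhidi2014, (5.5)] -/
def T3a (σ c : ℝ) : Laminate d :=
  Laminate.split ((c + r / 2) / r) (φ.ηa κ l) (-r) (Laminate.atom (φ.P κ l (σ * Real.sqrt r) 0 (r / 2))) (φ.T4a κ l r)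

/-- **(5.6)**: `(0, σB, c) = ν (0, σ√r, -r/2) + (1 - ν)(0, 0, r/2)`, `ν = (r/2 - c)/r`.
[cite: ChoffrutSzekelyhidi2014, (5.6)] -/
def T3b (σ c : ℝ) : Laminate d :=
  Laminate.split ((r / 2 - c) / r) (φ.ηb κ l) (-r) (Laminate.atom (φ.P κ l 0 (σ * Real.sqrt r) (-(r / 2)))) (φ.T4b κ l r)

/-- The sign `±1` of a real number (`1` at `0`). [folklore] -/
def sgn (x : ℝ) : ℝ := if 0 ≤ x then 1 else -1

/-- `A = (r/2 + c)/√r`. [folklore] -/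
def Ac (c : ℝ) : ℝ := (r / 2 + c) / Real.sqrt r

/-- `B = (r/2 - c)/√r`. [folklore] -/
def Bc (c : ℝ) : ℝ := (r / 2 - c) / Real.sqrt r

/-- **Boundary points**: `(a, b, c)` with `|a|/A + |b|/B = 1` splits horizontally into the corners
`(sgn a · A, 0, c)` and `(0, sgn b · B, c)` with weight `|a|/A`. [cite: ChoffrutSzekelyhidi2014, Prop. 14 (iv)] -/
def T2 (a b c : ℝ) : Laminate d :=
  Laminate.split (|a| / Ac r c)
    (φ.vec2 (-(κ * (sgn b * Bc r c)) + l * (sgn a * Ac r c)) (-(l * (sgn b * Bc r c)) - κ * (sgn a * Ac r c))) 0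
    (φ.T3a κ l r (sgn a) c) (φ.T3b κ l r (sgn b) c)

/-- `a₊ = A (1 - |b|/B)`: the `a`-coordinate where the horizontal line through `(a, b, c)` meets the
boundary of the rhombus slice. [folklore] -/
def aplus (b c : ℝ) : ℝ := Ac r c * (1 - |b| / Bc r c)

/-- **Interior points**: `(a, b, c)` splits along the `a`-direction into the boundary points
`(±a₊, b, c)`. [cite: ChoffrutSzekelyhidi2014, Prop. 14 (iv)] -/
def T1 (a b c : ℝ) : Laminate d :=
  Laminate.split (if aplus r b c = 0 then 1 / 2 else (1 + a / aplus r b c) / 2) (φ.ηa κ l) 0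
    (φ.T2 κ l r (aplus r b c) b c) (φ.T2 κ l r (-aplus r b c) b c)

/-! ## Elementary facts -/

variable {κ l r}

/-- `sgn x · |x| = x`. [folklore] -/
theorem sgn_mul_abs (x : ℝ) : sgn x * |x| = x := by
  unfold sgn; split_ifs with h
  · rw [one_mul, abs_of_nonneg h]
  · rw [abs_of_neg (not_le.1 h)]; ring

/-- `|sgn x| = 1`. [folklore] -/
theorem abs_sgn (x : ℝ) : |sgn x| = 1 := by unfold sgn; split_ifs <;> simp

/-- `sgn x ^ 2 = 1`. [folklore] -/
theorem sgn_sq (x : ℝ) : sgn x ^ 2 = 1 := by unfold sgn; split_ifs <;> norm_num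

section Basic

variable (hr : 0 < r)
include hr

/-- `√r > 0`. [folklore] -/
theorem sr_pos : 0 < Real.sqrt r := Real.sqrt_pos.2 hr

/-- `(√r)² = r`. [folklore] -/
theorem sr_sq : Real.sqrt r ^ 2 = r := Real.sq_sqrt hr.le

/-- `√r · √r = r`. [folklore] -/
theorem sr_mul_sr : Real.sqrt r * Real.sqrt r = r := Real.mul_self_sqrt hr.le

/-- `√r A = r/2 + c`. [folklore] -/
theorem sr_mul_Ac (c : ℝ) : Real.sqrt r * Ac r c = r / 2 + c := by
  unfold Ac; field_simp [(sr_pos hr).ne']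

/-- `√r B = r/2 - c`. [folklore] -/
theorem sr_mul_Bc (c : ℝ) : Real.sqrt r * Bc r c = r / 2 - c := by
  unfold Bc; field_simp [(sr_pos hr).ne']

/-- `A > 0` for `|c| < r/2`. [folklore] -/
theorem Ac_pos {c : ℝ} (hc : |c| < r / 2) : 0 < Ac r c := by
  unfold Ac; exact div_pos (by linarith [(abs_lt.1 hc).1]) (sr_pos hr)

/-- `B > 0` for `|c| < r/2`. [folklore] -/
theorem Bc_pos {c : ℝ} (hc : |c| < r / 2) : 0 < Bc r c := by
  unfold Bc; exact div_pos (by linarith [(abs_lt.1 hc).2]) (sr_pos hr)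

/-- `A² ≤ r` for `|c| ≤ r/2`. [folklore] -/
theorem Ac_sq_le {c : ℝ} (hc : |c| ≤ r / 2) : Ac r c ^ 2 ≤ r := by
  have h1 : (Real.sqrt r * Ac r c) ^ 2 ≤ r ^ 2 := by
    rw [sr_mul_Ac hr]
    have := (abs_le.1 hc).1; have := (abs_le.1 hc).2
    nlinarith
  rw [mul_pow, sr_sq hr] at h1
  nlinarith

/-- `B² ≤ r` for `|c| ≤ r/2`. [folklore] -/
theorem Bc_sq_le {c : ℝ} (hc : |c| ≤ r / 2) : Bc r c ^ 2 ≤ r := by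
  have h1 : (Real.sqrt r * Bc r c) ^ 2 ≤ r ^ 2 := by
    rw [sr_mul_Bc hr]
    have := (abs_le.1 hc).1; have := (abs_le.1 hc).2
    nlinarith
  rw [mul_pow, sr_sq hr] at h1
  nlinarith

/-- **`g` in terms of `A`, `B`**: `g_r(a, b, c) = r (|a| B + |b| A - A B)`. [folklore] -/
theorem gfun_eq (a b c : ℝ) : gfun r a b c = r * (|a| * Bc r c + |b| * Ac r c - Ac r c * Bc r c) := by
  have hA := sr_mul_Ac hr c
  have hB := sr_mul_Bc hr c
  have hs := sr_mul_sr hr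
  unfold gfun
  rw [← hA, ← hB]
  linear_combination (|a| * Bc r c + |b| * Ac r c - Ac r c * Bc r c) * hs

/-- **Boundary points of the rhombus slice lie in `V̄_r`**: `|x|/A + |b|/B = 1`, `|c| < r/2`. [cite: ChoffrutSzekelyhidi2014, (5.3)] -/
theorem mem_Wplane_bdry {x b c : ℝ} (hc : |c| < r / 2) (h : |x| / Ac r c + |b| / Bc r c = 1) : (x, b, c) ∈ Wplane r := by
  have hA := Ac_pos hr hc
  have hB := Bc_pos hr hc
  have h' : |x| * Bc r c + |b| * Ac r c = Ac r c * Bc r c := by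
    field_simp at h; linarith
  refine ⟨hc.le, ?_, ?_⟩
  · -- `x² + b² ≤ max(A², B²) ≤ r` via `u = |x|/A`, `v = |b|/B`, `u + v = 1`
    have hu0 : 0 ≤ |x| / Ac r c := div_nonneg (abs_nonneg _) hA.le
    have hv0 : 0 ≤ |b| / Bc r c := div_nonneg (abs_nonneg _) hB.le
    have hA2 := Ac_sq_le hr hc.le
    have hB2 := Bc_sq_le hr hc.le
    have hu1 : |x| / Ac r c ≤ 1 := by linarith
    have hv1 : |b| / Bc r c ≤ 1 := by linarith
    have e1 : x ^ 2 = (|x| / Ac r c) ^ 2 * Ac r c ^ 2 := by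
      rw [div_pow, div_mul_cancel₀ _ (pow_ne_zero 2 hA.ne'), sq_abs]
    have e2 : b ^ 2 = (|b| / Bc r c) ^ 2 * Bc r c ^ 2 := by
      rw [div_pow, div_mul_cancel₀ _ (pow_ne_zero 2 hB.ne'), sq_abs]
    show x ^ 2 + b ^ 2 ≤ r
    rw [e1, e2]
    set u := |x| / Ac r c
    set v := |b| / Bc r c
    have huv : u + v = 1 := h
    have k1 : u ^ 2 * Ac r c ^ 2 ≤ u * Ac r c ^ 2 := by nlinarith [mul_nonneg hu0 (sq_nonneg (Ac r c))]
    have k2 : v ^ 2 * Bc r c ^ 2 ≤ v * Bc r c ^ 2 := by nlinarith [mul_nonneg hv0 (sq_nonneg (Bc r c))]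
    have k3 : u * Ac r c ^ 2 ≤ u * r := mul_le_mul_of_nonneg_left hA2 hu0
    have k4 : v * Bc r c ^ 2 ≤ v * r := mul_le_mul_of_nonneg_left hB2 hv0
    nlinarith
  · show gfun r x b c ≤ 0
    rw [gfun_eq hr, h', sub_self, mul_zero]

/-- The corner `(σA, 0, c)`. [folklore] -/
theorem mem_Wplane_corner_a {σ c : ℝ} (hσ : |σ| = 1) (hc : |c| < r / 2) : (σ * Ac r c, 0, c) ∈ Wplane r :=
  mem_Wplane_bdry hr hc (by rw [abs_mul, hσ, one_mul, abs_of_pos (Ac_pos hr hc), abs_zero, zero_div, add_zero, div_self (Ac_pos hr hc).ne'])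

/-- The corner `(0, σB, c)`. [folklore] -/
theorem mem_Wplane_corner_b {σ c : ℝ} (hσ : |σ| = 1) (hc : |c| < r / 2) : (0, σ * Bc r c, c) ∈ Wplane r :=
  mem_Wplane_bdry hr hc (by rw [abs_mul, hσ, one_mul, abs_of_pos (Bc_pos hr hc), abs_zero, zero_div, zero_add, div_self (Bc_pos hr hc).ne'])

omit hr in
/-- `g` on the oblique segment (5.5) (a polynomial identity). [folklore] -/
theorem gfun_oblique_a (σ t : ℝ) (hσ : |σ| = 1) (ht : 0 ≤ t) (hs0 : 0 ≤ Real.sqrt r) :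
    gfun r (t * (σ * Real.sqrt r)) 0 (t * (r / 2) + (1 - t) * -(r / 2)) = t * (r - t * r) * (Real.sqrt r * Real.sqrt r - r) := by
  unfold gfun
  rw [abs_mul, abs_mul, hσ, one_mul, abs_of_nonneg ht, abs_of_nonneg hs0, abs_zero]
  ring

omit hr in
/-- `g` on the oblique segment (5.6). [folklore] -/
theorem gfun_oblique_b (σ t : ℝ) (hσ : |σ| = 1) (ht : 0 ≤ t) (hs0 : 0 ≤ Real.sqrt r) :
    gfun r 0 (t * (σ * Real.sqrt r)) (t * -(r / 2) + (1 - t) * (r / 2)) = t * (r - t * r) * (Real.sqrt r * Real.sqrt r - r) := by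
  unfold gfun
  rw [abs_mul, abs_mul, hσ, one_mul, abs_of_nonneg ht, abs_of_nonneg hs0, abs_zero]
  ring

omit hr in
/-- `g` on the cap segment (5.8). [folklore] -/
theorem gfun_cap_a (y : ℝ) : gfun r 0 y (-(r / 2)) = 0 := by
  unfold gfun; rw [abs_zero]; ring

omit hr in
/-- `g` on the cap segment (5.7). [folklore] -/
theorem gfun_cap_b (y : ℝ) : gfun r y 0 (r / 2) = 0 := by
  unfold gfun; rw [abs_zero]; ring

/-- **The oblique segment (5.5)** `[(σ√r, 0, r/2), (0, 0, -r/2)]` lies in `V̄_r` (on it `g = 0`). [cite: ChoffrutSzekelyhidi2014, (5.5)] -/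
theorem oblique_a_mem {σ : ℝ} (hσ : |σ| = 1) {t : ℝ} (ht0 : 0 ≤ t) (ht1 : t ≤ 1) :
    t • ((σ * Real.sqrt r, 0, r / 2) : ℝ × ℝ × ℝ) + (1 - t) • ((0, 0, -(r / 2)) : ℝ × ℝ × ℝ) ∈ Wplane r := by
  have hs := sr_mul_sr hr
  have hs0 := (sr_pos hr).le
  simp only [Prod.smul_mk, smul_eq_mul, mul_zero, Prod.mk_add_mk, add_zero]
  refine ⟨?_, ?_, ?_⟩
  · show |t * (r / 2) + (1 - t) * -(r / 2)| ≤ r / 2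
    rw [abs_le]; constructor <;> nlinarith
  · show (t * (σ * Real.sqrt r)) ^ 2 + (0 : ℝ) ^ 2 ≤ r
    have hσ2 : σ ^ 2 = 1 := by rw [← sq_abs, hσ]; norm_num
    rw [show (t * (σ * Real.sqrt r)) ^ 2 + (0 : ℝ) ^ 2 = t ^ 2 * (σ ^ 2 * (Real.sqrt r * Real.sqrt r)) by ring, hσ2, hs]
    nlinarith [mul_le_mul ht1 ht1 ht0 zero_le_one, hr]
  · show gfun r (t * (σ * Real.sqrt r)) 0 (t * (r / 2) + (1 - t) * -(r / 2)) ≤ 0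
    rw [gfun_oblique_a σ t hσ ht0 hs0, hs, sub_self, mul_zero]

/-- **The oblique segment (5.6)** `[(0, σ√r, -r/2), (0, 0, r/2)]` lies in `V̄_r`. [cite: ChoffrutSzekelyhidi2014, (5.6)] -/
theorem oblique_b_mem {σ : ℝ} (hσ : |σ| = 1) {t : ℝ} (ht0 : 0 ≤ t) (ht1 : t ≤ 1) :
    t • ((0, σ * Real.sqrt r, -(r / 2)) : ℝ × ℝ × ℝ) + (1 - t) • ((0, 0, r / 2) : ℝ × ℝ × ℝ) ∈ Wplane r := by
  have hs := sr_mul_sr hr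
  have hs0 := (sr_pos hr).le
  simp only [Prod.smul_mk, smul_eq_mul, mul_zero, Prod.mk_add_mk, add_zero]
  refine ⟨?_, ?_, ?_⟩
  · show |t * -(r / 2) + (1 - t) * (r / 2)| ≤ r / 2
    rw [abs_le]; constructor <;> nlinarith
  · show (0 : ℝ) ^ 2 + (t * (σ * Real.sqrt r)) ^ 2 ≤ r
    have hσ2 : σ ^ 2 = 1 := by rw [← sq_abs, hσ]; norm_num
    rw [show (0 : ℝ) ^ 2 + (t * (σ * Real.sqrt r)) ^ 2 = t ^ 2 * (σ ^ 2 * (Real.sqrt r * Real.sqrt r)) by ring, hσ2, hs]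
    nlinarith [mul_le_mul ht1 ht1 ht0 zero_le_one, hr]
  · show gfun r 0 (t * (σ * Real.sqrt r)) (t * -(r / 2) + (1 - t) * (r / 2)) ≤ 0
    rw [gfun_oblique_b σ t hσ ht0 hs0, hs, sub_self, mul_zero]

/-- **The cap segment (5.8)** `[(0, √r, -r/2), (0, -√r, -r/2)]` lies in `V̄_r`. [cite: ChoffrutSzekelyhidi2014, (5.8)] -/
theorem cap_a_mem {t : ℝ} (ht0 : 0 ≤ t) (ht1 : t ≤ 1) :
    t • ((0, Real.sqrt r, -(r / 2)) : ℝ × ℝ × ℝ) + (1 - t) • ((0, -Real.sqrt r, -(r / 2)) : ℝ × ℝ × ℝ) ∈ Wplane r := by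
  have hs := sr_mul_sr hr
  simp only [Prod.smul_mk, smul_eq_mul, mul_zero, Prod.mk_add_mk, add_zero]
  refine ⟨?_, ?_, ?_⟩
  · show |t * -(r / 2) + (1 - t) * -(r / 2)| ≤ r / 2
    rw [show t * -(r / 2) + (1 - t) * -(r / 2) = -(r / 2) by ring, abs_neg, abs_of_pos (by linarith)]
  · show (0 : ℝ) ^ 2 + (t * Real.sqrt r + (1 - t) * -Real.sqrt r) ^ 2 ≤ r
    nlinarith [hs, mul_nonneg ht0 (sub_nonneg.2 ht1)]
  · show gfun r 0 (t * Real.sqrt r + (1 - t) * -Real.sqrt r) (t * -(r / 2) + (1 - t) * -(r / 2)) ≤ 0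
    rw [show t * -(r / 2) + (1 - t) * -(r / 2) = -(r / 2) by ring, gfun_cap_a]

/-- **The cap segment (5.7)** `[(√r, 0, r/2), (-√r, 0, r/2)]` lies in `V̄_r`. [cite: ChoffrutSzekelyhidi2014, (5.7)] -/
theorem cap_b_mem {t : ℝ} (ht0 : 0 ≤ t) (ht1 : t ≤ 1) :
    t • ((Real.sqrt r, 0, r / 2) : ℝ × ℝ × ℝ) + (1 - t) • ((-Real.sqrt r, 0, r / 2) : ℝ × ℝ × ℝ) ∈ Wplane r := by
  have hs := sr_mul_sr hr
  simp only [Prod.smul_mk, smul_eq_mul, mul_zero, Prod.mk_add_mk, add_zero]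
  refine ⟨?_, ?_, ?_⟩
  · show |t * (r / 2) + (1 - t) * (r / 2)| ≤ r / 2
    rw [show t * (r / 2) + (1 - t) * (r / 2) = r / 2 by ring, abs_of_pos (by linarith)]
  · show (t * Real.sqrt r + (1 - t) * -Real.sqrt r) ^ 2 + (0 : ℝ) ^ 2 ≤ r
    nlinarith [hs, mul_nonneg ht0 (sub_nonneg.2 ht1)]
  · show gfun r (t * Real.sqrt r + (1 - t) * -Real.sqrt r) 0 (t * (r / 2) + (1 - t) * (r / 2)) ≤ 0
    rw [show t * (r / 2) + (1 - t) * (r / 2) = r / 2 by ring, gfun_cap_b]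

end Basic

/-! ## Barycentres -/

section Bary

/-- `bary T4a = R(0, 0, -r/2)`. [folklore] -/
theorem bary_T4a : (φ.T4a κ l r).bary = φ.P κ l 0 0 (-(r / 2)) := by
  rw [T4a, Laminate.bary_split, Laminate.bary_atom, Laminate.bary_atom, rot_convex]
  congr 1 <;> ring

/-- `bary T4b = R(0, 0, r/2)`. [folklore] -/
theorem bary_T4b : (φ.T4b κ l r).bary = φ.P κ l 0 0 (r / 2) := by
  rw [T4b, Laminate.bary_split, Laminate.bary_atom, Laminate.bary_atom, rot_convex]
  congr 1 <;> ring

variable (hr : 0 < r)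
include hr

/-- `bary (T3a σ c) = R(σA, 0, c)`. [folklore] -/
theorem bary_T3a (σ c : ℝ) : (φ.T3a κ l r σ c).bary = φ.P κ l (σ * Ac r c) 0 c := by
  rw [T3a, Laminate.bary_split, Laminate.bary_atom, bary_T4a, rot_convex]
  have hs := sr_mul_sr hr
  have hs0 := (sr_pos hr).ne'
  have hr0 := hr.ne'
  congr 1
  · rw [mul_zero, add_zero, Ac, div_mul_eq_mul_div, mul_div_assoc', div_eq_div_iff hr0 hs0]
    linear_combination (c + r / 2) * σ * hs
  · ring
  · field_simp; ring
  · ring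

/-- `bary (T3b σ c) = R(0, σB, c)`. [folklore] -/
theorem bary_T3b (σ c : ℝ) : (φ.T3b κ l r σ c).bary = φ.P κ l 0 (σ * Bc r c) c := by
  rw [T3b, Laminate.bary_split, Laminate.bary_atom, bary_T4b, rot_convex]
  have hs := sr_mul_sr hr
  have hs0 := (sr_pos hr).ne'
  have hr0 := hr.ne'
  congr 1
  · ring
  · rw [mul_zero, add_zero, Bc, div_mul_eq_mul_div, mul_div_assoc', div_eq_div_iff hr0 hs0]
    linear_combination (r / 2 - c) * σ * hs
  · field_simp; ring
  · ring

/-- `bary (T2 a b c) = R(a, b, c)` on the boundary of the slice. [folklore] -/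
theorem bary_T2 {a b c : ℝ} (hc : |c| < r / 2) (h : |a| / Ac r c + |b| / Bc r c = 1) :
    (φ.T2 κ l r a b c).bary = φ.P κ l a b c := by
  rw [T2, Laminate.bary_split, bary_T3a _ hr, bary_T3b _ hr, rot_convex]
  have hA := (Ac_pos hr hc).ne'
  have hB := (Bc_pos hr hc).ne'
  have hb : 1 - |a| / Ac r c = |b| / Bc r c := by linarith
  have e1 : |a| / Ac r c * (sgn a * Ac r c) + (1 - |a| / Ac r c) * 0 = a := by
    rw [mul_zero, add_zero]
    calc |a| / Ac r c * (sgn a * Ac r c) = sgn a * |a| * (Ac r c / Ac r c) := by ring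
      _ = a := by rw [div_self hA, mul_one, sgn_mul_abs]
  have e2 : |a| / Ac r c * 0 + (1 - |a| / Ac r c) * (sgn b * Bc r c) = b := by
    rw [mul_zero, zero_add, hb]
    calc |b| / Bc r c * (sgn b * Bc r c) = sgn b * |b| * (Bc r c / Bc r c) := by ring
      _ = b := by rw [div_self hB, mul_one, sgn_mul_abs]
  have e3 : |a| / Ac r c * c + (1 - |a| / Ac r c) * c = c := by ring
  have e4 : |a| / Ac r c * 0 + (1 - |a| / Ac r c) * 0 = 0 := by ring
  rw [e1, e2, e3, e4]

/-- `bary (T1 a b c) = R(a, b, c)` inside the slice. [folklore] -/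
theorem bary_T1 {a b c : ℝ} (hc : |c| < r / 2) (hab : |a| / Ac r c + |b| / Bc r c ≤ 1) :
    (φ.T1 κ l r a b c).bary = φ.P κ l a b c := by
  have hA := Ac_pos hr hc
  have hB := Bc_pos hr hc
  have hplus : 0 ≤ aplus r b c := mul_nonneg hA.le (by linarith [div_nonneg (abs_nonneg a) hA.le])
  have hbd : ∀ s : ℝ, |s| = 1 → |s * aplus r b c| / Ac r c + |b| / Bc r c = 1 := fun s hs => by
    rw [abs_mul, hs, one_mul, abs_of_nonneg hplus, aplus]; field_simp; ring
  have hbd1 := hbd 1 (by norm_num)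
  have hbd2 := hbd (-1) (by norm_num)
  rw [one_mul] at hbd1
  rw [neg_one_mul] at hbd2
  rw [T1, Laminate.bary_split, bary_T2 _ hr hc hbd1, bary_T2 _ hr hc hbd2, rot_convex]
  have hale : |a| ≤ aplus r b c := by
    have : |a| / Ac r c ≤ 1 - |b| / Bc r c := by linarith
    rw [div_le_iff₀ hA] at this
    rw [aplus]; linarith
  congr 1
  · split_ifs with h0
    · have : a = 0 := by rw [h0] at hale; exact abs_nonpos_iff.1 hale
      rw [this, h0]; ring
    · field_simp; ring
  · ring
  · ring
  · ring

end Bary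

/-! ## Validity -/

section Valid

variable (hκl : κ ^ 2 + l ^ 2 = 1) (hr : 0 < r)
include hκl hr

/-- `T4a` is valid in `R_θ V̄_r`. [cite: ChoffrutSzekelyhidi2014, (5.8)] -/
theorem isValid_T4a : (φ.T4a κ l r).IsValid (φ.Wrot κ l r) := by
  refine ⟨by norm_num, by norm_num, φ.vec2_ne_zero_of_sq hκl, ?_, ?_, ?_, ?_, ?_⟩
  · simp only [Laminate.bary_atom, rot_sub, sub_self]
    exact φ.inner_vel_rot_b κ l _ 0 0
  · simp only [Laminate.bary_atom, rot_sub, sub_self]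
    exact φ.mulVec_rot_horizontal κ l 0 _ _
  · rw [Laminate.bary_atom, Laminate.bary_atom]
    exact φ.segment_R3_subset (0, Real.sqrt r, -(r / 2)) (0, -Real.sqrt r, -(r / 2)) fun t ht0 ht1 => cap_a_mem hr ht0 ht1
  · exact ⟨(0, Real.sqrt r, -(r / 2)), by simpa using cap_a_mem hr zero_le_one le_rfl, rfl⟩
  · exact ⟨(0, -Real.sqrt r, -(r / 2)), by simpa using cap_a_mem hr le_rfl zero_le_one, rfl⟩

/-- `T4b` is valid in `R_θ V̄_r`. [cite: ChoffrutSzekelyhidi2014, (5.7)] -/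
theorem isValid_T4b : (φ.T4b κ l r).IsValid (φ.Wrot κ l r) := by
  refine ⟨by norm_num, by norm_num, φ.vec2_ne_zero_of_sq (by linarith [hκl] : (-l) ^ 2 + κ ^ 2 = 1), ?_, ?_, ?_, ?_, ?_⟩
  · simp only [Laminate.bary_atom, rot_sub, sub_self]
    exact φ.inner_vel_rot_a κ l _ 0 0
  · simp only [Laminate.bary_atom, rot_sub, sub_self]
    exact φ.mulVec_rot_horizontal κ l _ 0 _
  · rw [Laminate.bary_atom, Laminate.bary_atom]
    exact φ.segment_R3_subset (Real.sqrt r, 0, r / 2) (-Real.sqrt r, 0, r / 2) fun t ht0 ht1 => cap_b_mem hr ht0 ht1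
  · exact ⟨(Real.sqrt r, 0, r / 2), by simpa using cap_b_mem hr zero_le_one le_rfl, rfl⟩
  · exact ⟨(-Real.sqrt r, 0, r / 2), by simpa using cap_b_mem hr le_rfl zero_le_one, rfl⟩

/-- `T3a σ c` is valid in `R_θ V̄_r` (`|σ| = 1`, `|c| ≤ r/2`). [cite: ChoffrutSzekelyhidi2014, (5.5)] -/
theorem isValid_T3a {σ c : ℝ} (hσ : |σ| = 1) (hc : |c| ≤ r / 2) : (φ.T3a κ l r σ c).IsValid (φ.Wrot κ l r) := by
  have hc1 := (abs_le.1 hc).1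
  have hc2 := (abs_le.1 hc).2
  refine ⟨div_nonneg (by linarith) hr.le, (div_le_one hr).2 (by linarith),
    φ.vec2_ne_zero_of_sq (by linarith [hκl] : (-l) ^ 2 + κ ^ 2 = 1), ?_, ?_, ?_, ?_, isValid_T4a _ hκl hr⟩
  · simp only [bary_T4a, Laminate.bary_atom, rot_sub, sub_self]
    exact φ.inner_vel_rot_a κ l _ _ _
  · simp only [bary_T4a, Laminate.bary_atom, rot_sub, sub_self]
    rw [show -(r / 2) - r / 2 = -r by ring]
    exact φ.mulVec_rot_a hκl _ _
  · rw [bary_T4a, Laminate.bary_atom]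
    exact φ.segment_R3_subset (σ * Real.sqrt r, 0, r / 2) (0, 0, -(r / 2)) fun t ht0 ht1 => oblique_a_mem hr hσ ht0 ht1
  · exact ⟨(σ * Real.sqrt r, 0, r / 2), by simpa using oblique_a_mem hr hσ zero_le_one le_rfl, rfl⟩

/-- `T3b σ c` is valid in `R_θ V̄_r`. [cite: ChoffrutSzekelyhidi2014, (5.6)] -/
theorem isValid_T3b {σ c : ℝ} (hσ : |σ| = 1) (hc : |c| ≤ r / 2) : (φ.T3b κ l r σ c).IsValid (φ.Wrot κ l r) := by
  have hc1 := (abs_le.1 hc).1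
  have hc2 := (abs_le.1 hc).2
  refine ⟨div_nonneg (by linarith) hr.le, (div_le_one hr).2 (by linarith), φ.vec2_ne_zero_of_sq hκl, ?_, ?_, ?_, ?_,
    isValid_T4b _ hκl hr⟩
  · simp only [bary_T4b, Laminate.bary_atom, rot_sub, sub_self]
    exact φ.inner_vel_rot_b κ l _ _ _
  · simp only [bary_T4b, Laminate.bary_atom, rot_sub, sub_self]
    rw [show r / 2 - -(r / 2) = r by ring]
    exact φ.mulVec_rot_b hκl _ _
  · rw [bary_T4b, Laminate.bary_atom]
    exact φ.segment_R3_subset (0, σ * Real.sqrt r, -(r / 2)) (0, 0, r / 2) fun t ht0 ht1 => oblique_b_mem hr hσ ht0 ht1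
  · exact ⟨(0, σ * Real.sqrt r, -(r / 2)), by simpa using oblique_b_mem hr hσ zero_le_one le_rfl, rfl⟩

/-- `T2 a b c` is valid in `R_θ V̄_r` for boundary points of the slice. [cite: ChoffrutSzekelyhidi2014, Prop. 14 (iv)] -/
theorem isValid_T2 {a b c : ℝ} (hc : |c| < r / 2) (h : |a| / Ac r c + |b| / Bc r c = 1) :
    (φ.T2 κ l r a b c).IsValid (φ.Wrot κ l r) := by
  have hA := Ac_pos hr hc
  have hB := Bc_pos hr hc
  have hl0 : 0 ≤ |a| / Ac r c := div_nonneg (abs_nonneg _) hA.le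
  have hl1 : |a| / Ac r c ≤ 1 := by linarith [div_nonneg (abs_nonneg b) hB.le]
  refine ⟨hl0, hl1, ?_, ?_, ?_, ?_, isValid_T3a _ hκl hr (abs_sgn a) hc.le, isValid_T3b _ hκl hr (abs_sgn b) hc.le⟩
  · -- `η ≠ 0`: the rotation is invertible
    intro h0
    rw [vec2_eq_zero_iff] at h0
    obtain ⟨h1, h2⟩ := h0
    have hx : sgn a * Ac r c = 0 := by linear_combination l * h1 - κ * h2 - (sgn a * Ac r c) * hκl
    rw [mul_eq_zero] at hx
    rcases hx with hx | hx
    · have := abs_sgn a; rw [hx, abs_zero] at this; norm_num at this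
    · exact hA.ne' hx
  · rw [bary_T3a _ hr, bary_T3b _ hr, rot_sub, rot, vel_mk4, inner_vec2]
    ring
  · simp only [bary_T3a _ hr, bary_T3b _ hr, rot_sub, sub_self]
    exact φ.mulVec_rot_horizontal κ l _ _ _
  · rw [bary_T3a _ hr, bary_T3b _ hr]
    exact φ.segment_R3_subset (sgn a * Ac r c, 0, c) (0, sgn b * Bc r c, c) fun t ht0 ht1 =>
      slice_convex (mem_Wplane_corner_a hr (abs_sgn a) hc) (mem_Wplane_corner_b hr (abs_sgn b) hc) ht0 ht1

/-- `T1 a b c` is valid in `R_θ V̄_r` for points of the slice. [cite: ChoffrutSzekelyhidi2014, Prop. 14 (iv)] -/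
theorem isValid_T1 {a b c : ℝ} (hc : |c| < r / 2) (hab : |a| / Ac r c + |b| / Bc r c ≤ 1) :
    (φ.T1 κ l r a b c).IsValid (φ.Wrot κ l r) := by
  have hA := Ac_pos hr hc
  have hB := Bc_pos hr hc
  have hplus : 0 ≤ aplus r b c := mul_nonneg hA.le (by linarith [div_nonneg (abs_nonneg a) hA.le])
  have hbd : ∀ s : ℝ, |s| = 1 → |s * aplus r b c| / Ac r c + |b| / Bc r c = 1 := fun s hs => by
    rw [abs_mul, hs, one_mul, abs_of_nonneg hplus, aplus]; field_simp; ring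
  have hbd1 := hbd 1 (by norm_num)
  have hbd2 := hbd (-1) (by norm_num)
  rw [one_mul] at hbd1
  rw [neg_one_mul] at hbd2
  have hale : |a| ≤ aplus r b c := by
    have : |a| / Ac r c ≤ 1 - |b| / Bc r c := by linarith
    rw [div_le_iff₀ hA] at this
    rw [aplus]; linarith
  refine ⟨?_, ?_, φ.vec2_ne_zero_of_sq (by linarith [hκl] : (-l) ^ 2 + κ ^ 2 = 1), ?_, ?_, ?_,
    isValid_T2 _ hκl hr hc hbd1, isValid_T2 _ hκl hr hc hbd2⟩
  · split_ifs with h0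
    · norm_num
    · have hpos : 0 < aplus r b c := lt_of_le_of_ne hplus (Ne.symm h0)
      have : -1 ≤ a / aplus r b c := by
        rw [le_div_iff₀ hpos]; linarith [(abs_le.1 hale).1]
      linarith
  · split_ifs with h0
    · norm_num
    · have hpos : 0 < aplus r b c := lt_of_le_of_ne hplus (Ne.symm h0)
      have : a / aplus r b c ≤ 1 := by
        rw [div_le_iff₀ hpos]; linarith [(abs_le.1 hale).2]
      linarith
  · simp only [bary_T2 _ hr hc hbd1, bary_T2 _ hr hc hbd2, rot_sub, sub_self]
    exact φ.inner_vel_rot_a κ l _ _ _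
  · simp only [bary_T2 _ hr hc hbd1, bary_T2 _ hr hc hbd2, rot_sub, sub_self]
    exact φ.mulVec_rot_horizontal κ l _ _ _
  · rw [bary_T2 _ hr hc hbd1, bary_T2 _ hr hc hbd2]
    exact φ.segment_R3_subset (aplus r b c, b, c) (-aplus r b c, b, c) fun t ht0 ht1 =>
      slice_convex (mem_Wplane_bdry hr hc hbd1) (mem_Wplane_bdry hr hc hbd2) ht0 ht1

end Valid

/-! ## Atoms -/

section Atoms

variable (hκl : κ ^ 2 + l ^ 2 = 1) (hr : 0 < r)
include hκl hr

/-- The atoms `R(±√r, 0, r/2)`, `R(0, ±√r, -r/2)` lie in `𝒦_r`. [cite: ChoffrutSzekelyhidi2014, §5.1] -/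
theorem P_mem_K_a {σ : ℝ} (hσ : |σ| = 1) : φ.P κ l (σ * Real.sqrt r) 0 (r / 2) ∈ K r := by
  have hσ2 : σ ^ 2 = 1 := by rw [← sq_abs, hσ]; norm_num
  have hs := sr_sq hr
  refine φ.rot_mem_K hκl ?_ ?_ ?_
  · nlinarith [hσ2, hs]
  · nlinarith [hσ2, hs]
  · ring

/-- The atoms `R(0, ±√r, -r/2)` lie in `𝒦_r`. [cite: ChoffrutSzekelyhidi2014, §5.1] -/
theorem P_mem_K_b {σ : ℝ} (hσ : |σ| = 1) : φ.P κ l 0 (σ * Real.sqrt r) (-(r / 2)) ∈ K r := by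
  have hσ2 : σ ^ 2 = 1 := by rw [← sq_abs, hσ]; norm_num
  have hs := sr_sq hr
  refine φ.rot_mem_K hκl ?_ ?_ ?_
  · nlinarith [hσ2, hs]
  · nlinarith [hσ2, hs]
  · ring

/-- All atoms of `T4a` lie in `𝒦_r`. [folklore] -/
theorem allAtoms_T4a : (φ.T4a κ l r).AllAtoms (· ∈ K r) :=
  ⟨by simpa using φ.P_mem_K_b hκl hr (σ := 1) (by norm_num), by simpa using φ.P_mem_K_b hκl hr (σ := -1) (by norm_num)⟩

/-- All atoms of `T4b` lie in `𝒦_r`. [folklore] -/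
theorem allAtoms_T4b : (φ.T4b κ l r).AllAtoms (· ∈ K r) :=
  ⟨by simpa using φ.P_mem_K_a hκl hr (σ := 1) (by norm_num), by simpa using φ.P_mem_K_a hκl hr (σ := -1) (by norm_num)⟩

/-- All atoms of `T1 a b c` lie in `𝒦_r`. [folklore] -/
theorem allAtoms_T1 (a b c : ℝ) : (φ.T1 κ l r a b c).AllAtoms (· ∈ K r) := by
  have h3a : ∀ x c', (φ.T3a κ l r (sgn x) c').AllAtoms (· ∈ K r) := fun x c' =>
    ⟨φ.P_mem_K_a hκl hr (abs_sgn x), φ.allAtoms_T4a hκl hr⟩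
  have h3b : ∀ x c', (φ.T3b κ l r (sgn x) c').AllAtoms (· ∈ K r) := fun x c' =>
    ⟨φ.P_mem_K_b hκl hr (abs_sgn x), φ.allAtoms_T4b hκl hr⟩
  exact ⟨⟨h3a _ _, h3b _ _⟩, ⟨h3a _ _, h3b _ _⟩⟩

end Atoms

/-! ## Proposition 14 (iv) -/

/-- **Proposition 14 (iv), rotated**: every `R_θ(a, b, c)` with `|c| < r/2` and `g_r(a, b, c) ≤ 0`
(i.e. `f_r(a, b, c) ≤ 1`) is the barycentre of a laminate of order four, valid in `R_θ V̄_r`, with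
atoms in `𝒦_r`. [cite: ChoffrutSzekelyhidi2014, Prop. 14 (iv)] -/
theorem exists_planarLaminate (hκl : κ ^ 2 + l ^ 2 = 1) (hr : 0 < r) {a b c : ℝ} (hc : |c| < r / 2)
    (hg : gfun r a b c ≤ 0) :
    ∃ T : Laminate d, T.IsValid (φ.Wrot κ l r) ∧ T.bary = φ.rot κ l a b c 0 ∧ T.AllAtoms (· ∈ K r) := by
  have hA := Ac_pos hr hc
  have hB := Bc_pos hr hc
  have hab : |a| / Ac r c + |b| / Bc r c ≤ 1 := by
    rw [gfun_eq hr] at hg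
    have h1 : |a| * Bc r c + |b| * Ac r c ≤ Ac r c * Bc r c := by nlinarith [mul_pos hA hB]
    rw [div_add_div _ _ hA.ne' hB.ne', div_le_one (mul_pos hA hB)]
    linarith
  exact ⟨φ.T1 κ l r a b c, φ.isValid_T1 hκl hr hc hab, φ.bary_T1 hr hc hab, φ.allAtoms_T1 hκl hr a b c⟩


end Frame2

end StationaryEuler

end Literature.Analysis.FluidPDE
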